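import Mathlib.Analysis.Calculus.MeanValue
import Literature.Analysis.FluidPDE.KNSSThm53OfWindow
import Literature.Analysis.FluidPDE.KNSSWindowLipschitz
import HarnessLib

/-!
# Route PlaneEnergyCeiling · crux `BoundedPlanarEnergyRegularity` — zoom stub, step 1:
# the uniform space–time Lipschitz bound for bounded weak solutions with square-integrable slices

Helper file for the crux item stmt-NavierStokesRegularity-16921 (`BoundedPlanarEnergyRegularity`),
serving the zoom stub `stub_planarEnergyZoom` (= support item stmt-NavierStokesRegularity-16858) of
its line `birth`: the FINITE-ENERGY twin of
`KNSS2009_regularity_boundedWeak_window.lipschitz_of_cylRadius_bound`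
(`Literature/Analysis/FluidPDE/KNSSWindowLipschitz.lean`). From KNSS 2009, §4 on a window
(`KNSS2009_regularity_boundedWeak_window_holds`: (4.10)–(4.11) with the decomposition
`u = U + b(t)` of Lemma 3.1) we prove: for every `M` there is `K` such that every bounded weak
solution `u` (`ν = 1`) on `ℝ³ × (0, 1)`, continuous on the open slab, with `‖u‖ ≤ M` and with
square-integrable slices `u(t) ∈ L²(ℝ³)`, `t ∈ (0,1)`, satisfies
`‖u(t, x) − u(s, y)‖ ≤ K (|t − s| + ‖x − y‖)` for `s, t ∈ [1/2, 1)`.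

The only change with respect to the template is step (b), the control of the time oscillation of
the parasitic part `b`: at good times `s, t` and for every `ε > 0` there is a point `x` where both
`‖u(t, x)‖ ≤ ε` and `‖u(s, x)‖ ≤ ε` (Chebyshev: the super-level sets of two `L²` functions have
finite measure, while `ℝ³` has infinite measure), whence `‖b(t) − b(s)‖ ≤ 2ε + L|t − s|` — KNSS
2009, §1 p. 3: the parasitic solutions are excluded by finite energy. Steps (a), (c), (d) are
verbatim those of the template.

References: Koch–Nadirashvili–Seregin–Šverák, Acta Math. 203 (2009) = arXiv:0709.3599v1, §3
Lemma 3.1, §4 (4.10)–(4.11), §6 Lemma 6.1 and the proof of Thm. 6.1. [KochNadirashviliSereginSverak2009]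
-/

noncomputable section

-- single-conjunct summit: `Summit.<Summit>.<Problem>` repeats the name by the D-0017 layout
set_option linter.dupNamespace false

namespace Summit.NavierStokesRegularity.NavierStokesRegularity.Theorems.BoundedPlanarEnergyRegularity

open MeasureTheory Set Function Filter Topology TopologicalSpace
open scoped ENNReal NNReal
open Literature.Analysis.FluidPDE

/-- **Two square-integrable continuous fields on `ℝ³` are simultaneously small somewhere.** If
`f, g : ℝ³ → ℝ³` are in `L²`, then for every `ε > 0` there is a point `x` with `‖f x‖ ≤ ε` and
`‖g x‖ ≤ ε` (the super-level sets `{ε ≤ ‖f‖}`, `{ε ≤ ‖g‖}` have finite measure by Chebyshev,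
`ℝ³` has infinite measure). -/
theorem exists_norm_le_and_norm_le_of_memLp
    {f g : EuclideanSpace ℝ (Fin 3) → EuclideanSpace ℝ (Fin 3)}
    (hf : MemLp f 2 volume) (hg : MemLp g 2 volume) {ε : ℝ} (hε : 0 < ε) :
    ∃ x, ‖f x‖ ≤ ε ∧ ‖g x‖ ≤ ε := by
  by_contra hno
  push Not at hno
  set e : ℝ≥0 := ⟨ε, hε.le⟩ with he
  have he0 : e ≠ 0 := by
    rw [← NNReal.coe_ne_zero]
    exact hε.ne'
  have hA : volume {x | e ≤ ‖f x‖₊} < ∞ := hf.meas_ge_lt_top two_ne_zero ENNReal.ofNat_ne_top he0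
  have hB : volume {x | e ≤ ‖g x‖₊} < ∞ := hg.meas_ge_lt_top two_ne_zero ENNReal.ofNat_ne_top he0
  have hcover : (univ : Set (EuclideanSpace ℝ (Fin 3))) ⊆ {x | e ≤ ‖f x‖₊} ∪ {x | e ≤ ‖g x‖₊} := by
    intro x _
    rcases le_or_gt ‖f x‖ ε with h1 | h1
    · right
      have h2 := hno x h1
      show e ≤ ‖g x‖₊
      rw [← NNReal.coe_le_coe, coe_nnnorm]
      exact h2.le
    · left
      show e ≤ ‖f x‖₊
      rw [← NNReal.coe_le_coe, coe_nnnorm]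
      exact h1.le
  have huniv : volume (univ : Set (EuclideanSpace ℝ (Fin 3))) = ∞ :=
    measure_univ_of_isAddLeftInvariant volume
  have hle : volume (univ : Set (EuclideanSpace ℝ (Fin 3))) ≤
      volume {x | e ≤ ‖f x‖₊} + volume {x | e ≤ ‖g x‖₊} :=
    (measure_mono hcover).trans (measure_union_le _ _)
  rw [huniv] at hle
  exact absurd (top_le_iff.1 hle) (ENNReal.add_lt_top.2 ⟨hA, hB⟩).ne

-- adapted from Literature/Analysis/FluidPDE/KNSSWindowLipschitz.lean
-- (KNSS2009_regularity_boundedWeak_window.lipschitz_of_cylRadius_bound)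
/-- **Uniform space–time Lipschitz bound for bounded weak solutions with square-integrable
slices, from KNSS 2009, §4 on a window.** For every `M` there is `K ≥ 0` such that every bounded
weak solution `u` of Navier–Stokes (`ν = 1`) on `ℝ³ × (0, 1)` (`IsBoundedWeakNSSolutionOn (Ioo 0 1)`),
continuous on the open slab `(0, 1) × ℝ³`, with `‖u(t, x)‖ ≤ M` and `u(t) ∈ L²(ℝ³)` for every
`t ∈ (0,1)`, satisfies `‖u(t, x) − u(s, y)‖ ≤ K (|t − s| + ‖x − y‖)` for all `s, t ∈ [1/2, 1)`,
`x, y ∈ ℝ³`. The window fact gives `u(t, ·) = U(t, ·) + b(t)` with `‖∇U‖ ≤ C(1, ¼)`,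
`‖U(t,x) − U(s,x)‖ ≤ L(0, ¼)|t − s|` on `(¼, 1)`; finite energy kills the oscillation of `b`
(`exists_norm_le_and_norm_le_of_memLp`). -/
theorem lipschitz_of_memLp_two :
    ∀ (M : ℝ), ∃ K : ℝ, 0 ≤ K ∧ ∀ ⦃u : ℝ → EuclideanSpace ℝ (Fin 3) → EuclideanSpace ℝ (Fin 3)⦄,
      Literature.Analysis.FluidPDE.IsBoundedWeakNSSolutionOn (Set.Ioo 0 1) isOpen_Ioo 1 u →
      ContinuousOn (Function.uncurry u) (Set.Ioo (0 : ℝ) 1 ×ˢ Set.univ) →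
      (∀ t ∈ Set.Ioo (0 : ℝ) 1, ∀ x, ‖u t x‖ ≤ M) →
      (∀ t ∈ Set.Ioo (0 : ℝ) 1, MeasureTheory.MemLp (u t) 2 MeasureTheory.volume) →
      ∀ s ∈ Set.Ico (1 / 2 : ℝ) 1, ∀ t ∈ Set.Ico (1 / 2 : ℝ) 1, ∀ x y : EuclideanSpace ℝ (Fin 3),
        ‖u t x - u s y‖ ≤ K * (|t - s| + ‖x - y‖) := by
  intro M
  obtain ⟨Cf, L, N, hmain⟩ := KNSS2009_regularity_boundedWeak_window_holds M 1 one_pos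
  set C₁ : ℝ := |Cf 1 (1 / 4)| with hC₁
  set L₀ : ℝ := |L 0 (1 / 4)| with hL₀
  set K : ℝ := C₁ + 2 * L₀ with hK
  have hC₁0 : 0 ≤ C₁ := abs_nonneg _
  have hL₀0 : 0 ≤ L₀ := abs_nonneg _
  refine ⟨K, by positivity, ?_⟩
  intro u hu hcont hM hL2
  obtain ⟨U, b, -, -, -, hae, hsmooth, -, hD, hL, -⟩ := hmain hu hM
  have hδ : (0 : ℝ) < 1 / 4 := by norm_num
  -- slices of `u` are continuous
  have hslice : ∀ t ∈ Ioo (0 : ℝ) 1, Continuous (u t) := fun t ht =>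
    hcont.comp_continuous (Continuous.prodMk_right t) fun x => ⟨ht, mem_univ x⟩
  -- (a) good times: `u t = U t + b t` everywhere
  set Gd : Set ℝ := {t | t ∈ Ioo (0 : ℝ) 1 → u t = fun x => U t x + b t} with hGd
  have hgood : ∀ᵐ t ∂(volume : Measure ℝ), t ∈ Gd := by
    have h1 := (ae_restrict_iff' (measurableSet_Ioo (a := (0 : ℝ)) (b := 1))).1 hae
    filter_upwards [h1] with t ht ht'
    have hcU : Continuous fun x => U t x + b t :=
      (hsmooth t ht').continuous.add continuous_const
    exact Measure.eq_of_ae_eq (ht ht') (hslice t ht') hcU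
  have hdense : Dense Gd := Measure.dense_of_ae hgood
  -- (b)–(c) the estimate at good times of `(1/4, 1)`
  have hest : ∀ s t : ℝ, s ∈ Ioo (1 / 4 : ℝ) 1 → t ∈ Ioo (1 / 4 : ℝ) 1 → s ∈ Gd → t ∈ Gd →
      ∀ x y : (EuclideanSpace ℝ (Fin 3)), ‖u t x - u s y‖ ≤ K * (|t - s| + ‖x - y‖) := by
    intro s t hs ht hsG htG x y
    have hs' : s ∈ Ioo (0 : ℝ) 1 := ⟨by linarith [hs.1], hs.2⟩
    have ht' : t ∈ Ioo (0 : ℝ) 1 := ⟨by linarith [ht.1], ht.2⟩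
    have hus : ∀ z, u s z = U s z + b s := fun z => congrFun (hsG hs') z
    have hut : ∀ z, u t z = U t z + b t := fun z => congrFun (htG ht') z
    -- time-Lipschitz bound for `U` at order zero
    have hUt : ∀ z, ‖U t z - U s z‖ ≤ L₀ * |t - s| := fun z => by
      have h := hL (1 / 4) hδ 0 s hs t ht z
      rw [norm_iteratedFDeriv_zero_sub] at h
      exact h.trans (mul_le_mul_of_nonneg_right (le_abs_self _) (abs_nonneg _))
    -- (b) the parasitic part: `‖b t - b s‖ ≤ L₀ |t - s|`, at points where both slices are small
    have hb : ‖b t - b s‖ ≤ L₀ * |t - s| := by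
      have hR : ∀ ε : ℝ, 0 < ε → ‖b t - b s‖ ≤ 2 * ε + L₀ * |t - s| := by
        intro ε hε
        obtain ⟨xR, h1, h2⟩ := exists_norm_le_and_norm_le_of_memLp (hL2 t ht') (hL2 s hs') hε
        have heq : b t - b s = (u t xR - u s xR) - (U t xR - U s xR) := by
          rw [hut xR, hus xR]; abel
        calc ‖b t - b s‖ = ‖(u t xR - u s xR) - (U t xR - U s xR)‖ := by rw [heq]
          _ ≤ ‖u t xR‖ + ‖u s xR‖ + ‖U t xR - U s xR‖ :=
              (norm_sub_le _ _).trans (add_le_add (norm_sub_le _ _) le_rfl)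
          _ ≤ ε + ε + L₀ * |t - s| := add_le_add (add_le_add h1 h2) (hUt xR)
          _ = 2 * ε + L₀ * |t - s| := by ring
      have hlim : Tendsto (fun ε : ℝ => 2 * ε + L₀ * |t - s|) (𝓝[>] 0)
          (𝓝 (2 * 0 + L₀ * |t - s|)) :=
        ((tendsto_nhdsWithin_of_tendsto_nhds tendsto_id).const_mul 2).add tendsto_const_nhds
      rw [mul_zero, zero_add] at hlim
      exact ge_of_tendsto hlim (eventually_nhdsWithin_of_forall fun ε hε => hR ε hε)
    -- (c) the smooth part in space: mean value inequality
    have hUx : ‖U t x - U t y‖ ≤ C₁ * ‖x - y‖ := by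
      have hdiff : ∀ z ∈ (univ : Set (EuclideanSpace ℝ (Fin 3))), DifferentiableAt ℝ (U t) z :=
        fun z _ => ((hsmooth t ht').differentiable (by simp)) z
      have hbound : ∀ z ∈ (univ : Set (EuclideanSpace ℝ (Fin 3))), ‖fderiv ℝ (U t) z‖ ≤ C₁ :=
        fun z _ => by
          rw [← norm_iteratedFDeriv_one]
          exact (hD (1 / 4) hδ 1 t ht z).trans (le_abs_self _)
      exact Convex.norm_image_sub_le_of_norm_fderiv_le hdiff hbound convex_univ (mem_univ y)
        (mem_univ x)
    -- assemble
    have heq : u t x - u s y = (U t x - U t y) + (U t y - U s y) + (b t - b s) := by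
      rw [hut x, hus y]; abel
    calc ‖u t x - u s y‖ = ‖(U t x - U t y) + (U t y - U s y) + (b t - b s)‖ := by rw [heq]
      _ ≤ ‖U t x - U t y‖ + ‖U t y - U s y‖ + ‖b t - b s‖ :=
          (norm_add_le _ _).trans (add_le_add (norm_add_le _ _) le_rfl)
      _ ≤ C₁ * ‖x - y‖ + L₀ * |t - s| + L₀ * |t - s| := add_le_add (add_le_add hUx (hUt y)) hb
      _ ≤ K * (|t - s| + ‖x - y‖) := by rw [hK]; nlinarith [abs_nonneg (t - s), norm_nonneg (x - y)]
  -- (d) density of good times and continuity of `u`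
  intro s hs t ht x y
  have hO : IsOpen (Ioo (1 / 4 : ℝ) 1) := isOpen_Ioo
  have hsub := hdense.open_subset_closure_inter hO
  have hsO : s ∈ Ioo (1 / 4 : ℝ) 1 := ⟨by linarith [hs.1], hs.2⟩
  have htO : t ∈ Ioo (1 / 4 : ℝ) 1 := ⟨by linarith [ht.1], ht.2⟩
  obtain ⟨sq, hsq, hsql⟩ := mem_closure_iff_seq_limit.1 (hsub hsO)
  obtain ⟨tq, htq, htql⟩ := mem_closure_iff_seq_limit.1 (hsub htO)
  have hn : ∀ n, ‖u (tq n) x - u (sq n) y‖ ≤ K * (|tq n - sq n| + ‖x - y‖) := fun n =>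
    hest (sq n) (tq n) (hsq n).1 (htq n).1 (hsq n).2 (htq n).2 x y
  have hopen : IsOpen (Ioo (0 : ℝ) 1 ×ˢ (univ : Set (EuclideanSpace ℝ (Fin 3)))) :=
    isOpen_Ioo.prod isOpen_univ
  have hct : Tendsto (fun n => u (tq n) x) atTop (𝓝 (u t x)) := by
    have h1 : ContinuousAt (uncurry u) (t, x) :=
      hcont.continuousAt (hopen.mem_nhds ⟨⟨by linarith [ht.1], ht.2⟩, mem_univ x⟩)
    exact h1.tendsto.comp (htql.prodMk_nhds tendsto_const_nhds)
  have hcs : Tendsto (fun n => u (sq n) y) atTop (𝓝 (u s y)) := by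
    have h1 : ContinuousAt (uncurry u) (s, y) :=
      hcont.continuousAt (hopen.mem_nhds ⟨⟨by linarith [hs.1], hs.2⟩, mem_univ y⟩)
    exact h1.tendsto.comp (hsql.prodMk_nhds tendsto_const_nhds)
  refine le_of_tendsto_of_tendsto' (hct.sub hcs).norm ?_ hn
  exact (((continuous_abs.tendsto _).comp (htql.sub hsql)).add tendsto_const_nhds).const_mul K

end Summit.NavierStokesRegularity.NavierStokesRegularity.Theorems.BoundedPlanarEnergyRegularity

end
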